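import Summits.ResolutionOfSingularities.ResolutionOfSingularities.Theorems.FrobeniusLadderFInjectiveMacaulayficationLocalFullificationFibreAdmGe4Split
import Summits.ResolutionOfSingularities.ResolutionOfSingularities.Theorems.FrobeniusLadderFInjectiveMacaulayficationTrFullStepDoor
import Summits.ResolutionOfSingularities.ResolutionOfSingularities.Theorems.FrobeniusLadderFInjectiveMacaulayficationFullCentreDescent
import Summits.ResolutionOfSingularities.ResolutionOfSingularities.Theorems.FrobeniusLadderFInjectiveMacaulayficationFTemkinClosedPoints
import Summits.ResolutionOfSingularities.ResolutionOfSingularities.Theorems.FrobeniusLadderFInjectiveMacaulayficationRegularBlowupModelDim2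
import Literature.AlgebraicGeometry.Resolution.Temkin2008Localization
import HarnessLib

/-!
# «TT» — THE INTRINSIC-CENTRE TOWER: a KILLABLE canonical-process form of the F-half — SORRY-FREE (TT-K)
# (crux `FInjectiveMacaulayfication` stmt-ResolutionOfSingularities-15315, chain w45a; res-L1-w45a-plan-1 g19 RULING R19.2: the planner desk file
# `L/w45a/TauTowerSig.lean` sha16 b169b73bd89e0ff3 VERBATIM (§1 recipe, §2 conjecture, §4 door term) with its two commissioned `sorry`s (§3) now PROVED;
# (TT-K) owner res-L1-w45a-stub-2 g8; Lemma A is ONE instance of res-L1-w45a-lead-1 g9's generic `FullCentreDescent.exists_fullCentre_of_tower`)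

[OURS · L1 W4.5a] Support file (`--supports stmt-ResolutionOfSingularities-15315 --as helper`); NOT a statement of any manuscript; the definitions and the
`@[conjecture]` are the desk's; the theorems are unconditional except the door term (conditional BY NAME on four published theorems + (TT) + T″(p,e,1)).
AI-written (AI review is weaker than expert review).

Door v41 `Lines/step_door.lean`; the open F-half stub is `LocalFullificationFibreAdmGe4Split.LocalFInjectivizationFibreAdmGe4` (∃ a fibre-supported centre
𝓚 whose blow-ups are FULL everywhere) — an ∃-statement no computation can refute. This file TYPES the intrinsic recipe observed by res-L1-w45a-idea-1
(FB5-r4 §2.5–§2.6: on every decided p = 2, d = 4 bed row the tower «blow up the REDUCED closure of the non-FULL locus, repeat» ends FULL, every floor CM,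
no loop, ≤ 35 charts):

* `nonFullLocus p S`, `centre p S` := the vanishing (reduced) ideal sheaf of the closure of the non-FULL locus (Mathlib `Scheme.IdealSheafData.vanishingIdeal`);
* `TowerFull p n S` := following the recipe for `n` floors from `S` ends FULL at every point (structural recursion on `n`; NO Cohen–Macaulay clause on
  intermediate floors — not needed for the implication below; CM-at-every-floor stays idea-1's empirical observation);
* `IntrinsicTowerConjecture` := the F-half's binders VERBATIM, conclusion `∃ n, TowerFull p n S′` — KILLABLE BY ONE FLOOR (a floor whose recipe tower
  loops or never purifies refutes it; kill criteria K-TT-a/b/c of R19.2);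
* ★ Lemma A `exists_fibreCentre_of_towerFull` — PROVED: `TowerFull p n S` ∧ FULL off a closed set `F` missing a point ∧ `S` Noetherian integral ⇒ ∃ 𝓚 ≠ ⊥
  supported in `F` with EVERY blow-up along 𝓚 FULL everywhere = `FullCentreDescent.exists_fullCentre_of_tower` at `T := TowerFull p`, `c := centre p`
  (`hc`: the support of the vanishing ideal of `closure (nonFullLocus)` IS that closed set, which lies in every closed `F` off which `S` is FULL; `h0`, `hsucc`:
  the two defining clauses of `TowerFull`);
* ★★ `localFInjectivizationFibreAdmGe4_of_intrinsicTowerConjecture` — PROVED: TT ⇒ F-half (Lemma A with `F` := the closed fibre of `g`: closed as the preimage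
  of the closed point; PROPER because the generic point of `Spec 𝒪_{X,x}` is regular (`genericPoint_mem_regularLocus`), hence off `supp I ⊆ (Reg)ᶜ`, so the
  blowing up `g` has a point over it (`IsBlowup.isIso_compl`), and it is not the closed point because `x ∉ Reg X` (`mem_regularLocus_iff_of_flat_of_isPreimmersion`
  along the flat `X.fromSpecStalk x`); off the fibre `S′` is regular ⇒ FULL by `FTemkinClosedPoints.fullCl_of_isRegularLocalRing`, the stalks having
  characteristic `p` over `k` (`charP_stalk_of_over`); `S′` is Noetherian integral as a blowing up of the Noetherian local scheme along `I ≠ ⊥`);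
* `fInjectiveMacaulayfication_of_prints_of_TT_of_tStepOne` : the v41 door term with the F-half := TT (candidate line v42 «INTRINSIC-CENTRE», by evidence
  only: its residue is kernel-STRONGER than v41's, so it does not replace v41 — R18.7).
Everything OURS, counted 0; NOTHING of the crux is proved here: the crux now follows BY NAME from {four prints, (TT), T″(p,e,1)}, and (TT) is refutable by
one computation. [folklore assembly; cite: Temkin2008, Lemma 2.1.4; StacksProject, Tag 080B; Tag 02OS; GortzWedhorn2020, (13.19) p. 413]
-/

set_option linter.dupNamespace false

noncomputable section

open AlgebraicGeometry CategoryTheory CategoryTheory.Limits Literature.AlgebraicGeometry.Resolution TopologicalSpace IsLocalRing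

namespace Summit.ResolutionOfSingularities.ResolutionOfSingularities.Theorems.FInjectiveMacaulayfication.IntrinsicTower

open Summit.ResolutionOfSingularities.ResolutionOfSingularities.Theorems.FInjectiveMacaulayfication
open SliceableCentre

/-! ## §1 The recipe -/

/-- The non-FULL locus of a scheme: points whose stalk has a parameter ideal that is not Frobenius closed. [OURS] -/
def nonFullLocus (p : ℕ) (S : Scheme.{0}) : Set S := {s | ¬ FullCl p (S.presheaf.stalk s)}

/-- THE INTRINSIC CENTRE: the reduced (vanishing) ideal sheaf of the closure of the non-FULL locus. [OURS] -/
def centre (p : ℕ) (S : Scheme.{0}) : S.IdealSheafData :=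
  Scheme.IdealSheafData.vanishingIdeal ⟨closure (nonFullLocus p S), isClosed_closure⟩

/-- `TowerFull p n S`: EVERY chain of `n` blowing ups, each along the intrinsic centre of the floor below, starting at `S`, ends at a scheme that is
FULL at every point (blow-ups are unique up to unique isomorphism, so «every» = «the»). [OURS] -/
def TowerFull (p : ℕ) : ℕ → Scheme.{0} → Prop
  | 0 => fun S => ∀ s : S, FullCl p (S.presheaf.stalk s)
  | n + 1 => fun S => ∀ (S₁ : Scheme.{0}) (g : S₁ ⟶ S), IsBlowup g (centre p S) → TowerFull p n S₁

/-- Floor zero of the recipe, unfolded. [OURS] -/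
theorem towerFull_zero {p : ℕ} {S : Scheme.{0}} : TowerFull p 0 S ↔ ∀ s : S, FullCl p (S.presheaf.stalk s) := Iff.rfl

/-- The successor clause of the recipe, unfolded. [OURS] -/
theorem towerFull_succ {p n : ℕ} {S : Scheme.{0}} :
    TowerFull p (n + 1) S ↔ ∀ (S₁ : Scheme.{0}) (g : S₁ ⟶ S), IsBlowup g (centre p S) → TowerFull p n S₁ := Iff.rfl

/-- The intrinsic centre is supported on the closure of the non-FULL locus, hence inside every CLOSED set off which the scheme is FULL. [folklore] -/
theorem support_centre_subset (p : ℕ) (S : Scheme.{0}) (F : Set S) (hF : IsClosed F)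
    (hfull : ∀ s : S, s ∉ F → FullCl p (S.presheaf.stalk s)) : ((centre p S).support : Set S) ⊆ F :=
  FullCentreDescent.vanishingIdeal_support_subset _ F
    (closure_minimal (fun s hs => Classical.byContradiction fun h => hs (hfull s h)) hF)

/-! ## §2 The killable conjecture -/

/-- [OURS · CANDIDATE statement, KILLABLE] **(TT) THE INTRINSIC-CENTRE TOWER TERMINATES.** Binders VERBATIM those of the F-half
`LocalFullificationFibreAdmGe4Split.LocalFInjectivizationFibreAdmGe4`; conclusion: for some `n`, the tower of `n` blowing ups along the successive
intrinsic centres (reduced closure of the non-FULL locus) of `S′` ends FULL everywhere. One floor whose tower loops or never purifies refutes it. -/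
@[conjecture] def IntrinsicTowerConjecture : Prop :=
  ∀ d : ℕ, 4 ≤ d →
  ∀ (p : ℕ), p.Prime → ∀ (k : Type) [Field k] [CharP k p]
    (X : Scheme.{0}) (f : X ⟶ Spec (.of k)),
      IsSeparated f → LocallyOfFiniteType f → QuasiCompact f → IsIntegral X →
  ∀ x : X, IsClosed ({x} : Set X) → x ∉ Scheme.regularLocus X → ringKrullDim (X.presheaf.stalk x) = d →
  ∀ (S' : Scheme.{0}) (g : S' ⟶ Spec (X.presheaf.stalk x)) (I : (Spec (X.presheaf.stalk x)).IdealSheafData),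
    I ≠ ⊥ → (I.support : Set (Spec (X.presheaf.stalk x))) ⊆ (Scheme.regularLocus (Spec (X.presheaf.stalk x)))ᶜ → IsBlowup g I →
    (∀ s : S', g.base s ≠ closedPoint (X.presheaf.stalk x) → s ∈ Scheme.regularLocus S') →
    (∀ s : S', CMCl (S'.presheaf.stalk s)) →
    ∃ n : ℕ, TowerFull p n S'

/-! ## §3 The two kernel targets of R19.2, PROVED -/

/-- ★ **Lemma A** (generic). If the intrinsic tower of height `n` from a Noetherian integral `S` ends FULL, and `S` is already FULL off a closed set `F`
missing at least one point, then ONE blowing up along a centre `𝓚 ≠ ⊥` supported in `F` FULL-ifies `S` (every blow-up along `𝓚` is FULL at every point):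
the instance `T := TowerFull p`, `c := centre p` of res-L1-w45a-lead-1's `FullCentreDescent.exists_fullCentre_of_tower` (induction on `n`: floor zero `𝓚 = ⊤`;
at `n + 1` blow up the centre — `≠ ⊥` because its support lies in the proper closed `F` —, transport «Noetherian integral, FULL off the proper closed
`g⁻¹F`», recurse, and contract the two blowing ups to one supported in `F` by Temkin 2.1.4 / Stacks 080B, FULL transported along `IsBlowup.unique`).
[folklore assembly; cite: Temkin2008, Lemma 2.1.4] [cite: StacksProject, Tag 080B] -/
theorem exists_fibreCentre_of_towerFull (p : ℕ) :
    ∀ (n : ℕ) (S : Scheme.{0}) [IsNoetherian S] [IsIntegral S] (F : Set S), IsClosed F → (∃ s : S, s ∉ F) →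
      (∀ s : S, s ∉ F → FullCl p (S.presheaf.stalk s)) → TowerFull p n S →
      ∃ 𝓚 : S.IdealSheafData, 𝓚 ≠ ⊥ ∧ (∀ s ∈ (𝓚.support : Set S), s ∈ F) ∧
        ∀ (S'' : Scheme.{0}) (π : S'' ⟶ S), IsBlowup π 𝓚 → ∀ s : S'', FullCl p (S''.presheaf.stalk s) :=
  FullCentreDescent.exists_fullCentre_of_tower p (TowerFull p) (centre p)
    (fun S _ _ F hF hfull => support_centre_subset p S F hF hfull) (fun _ h => h) (fun _ _ h => h)

/-- ★★ **TT ⇒ F-half.** Lemma A with `F` := the closed fibre `{s | g s = closed point}` of `g : S′ ⟶ Spec 𝒪_{X,x}`: it is closed (preimage of the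
closed point); it misses a point (the generic point `η` of `Spec 𝒪_{X,x}` is regular, hence `η ∉ supp I ⊆ (Reg)ᶜ`, so the blowing up `g` is an
isomorphism over a neighbourhood of `η` and some `s′ ↦ η`; and `η ≠` closed point since otherwise the closed point were regular and, `X.fromSpecStalk x`
being flat, `x ∈ Reg X`); `S′` is FULL off it (regular there by hypothesis; regular local rings of characteristic `p` are FULL); `S′` is Noetherian
integral (a blowing up of the Noetherian local scheme along `I ≠ ⊥`). [folklore assembly; cite: Temkin2008, Lemma 2.1.4 and §2.1; StacksProject, Tag 02OS] -/
theorem localFInjectivizationFibreAdmGe4_of_intrinsicTowerConjecture (hTT : IntrinsicTowerConjecture) :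
    LocalFullificationFibreAdmGe4Split.LocalFInjectivizationFibreAdmGe4 := by
  intro d hd p hp k _ _ X f hsep hft hqc hint x hxcl hxs hx S' g I hI hIadm hg hreg hcm
  classical
  haveI : Fact p.Prime := ⟨hp⟩
  haveI : IsLocallyNoetherian X := LocallyOfFiniteType.isLocallyNoetherian f
  haveI : IsIntegral S' := hg.isIntegral hI
  haveI : IsProper g := hg.isProper
  haveI : IsLocallyNoetherian S' := LocallyOfFiniteType.isLocallyNoetherian g
  haveI : CompactSpace S' := QuasiCompact.compactSpace_of_compactSpace g
  haveI : IsNoetherian S' := {}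
  obtain ⟨n, hn⟩ := hTT d hd p hp k X f hsep hft hqc hint x hxcl hxs hx S' g I hI hIadm hg hreg hcm
  -- the closed fibre
  let F : Set S' := {s | g.base s = closedPoint (X.presheaf.stalk x)}
  have hFcl : IsClosed F := by
    have hcp : IsClosed ({closedPoint (X.presheaf.stalk x)} : Set (Spec (X.presheaf.stalk x))) :=
      (PrimeSpectrum.isClosed_singleton_iff_isMaximal _).mpr (IsLocalRing.maximalIdeal.isMaximal _)
    exact hcp.preimage g.continuous
  -- the generic point of `Spec 𝒪_{X,x}` is regular, off `supp I`, and not the closed point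
  have hηreg : genericPoint (Spec (X.presheaf.stalk x)) ∈ Scheme.regularLocus (Spec (X.presheaf.stalk x)) :=
    genericPoint_mem_regularLocus _
  have hηI : genericPoint (Spec (X.presheaf.stalk x)) ∉ (I.support : Set (Spec (X.presheaf.stalk x))) := fun h => hIadm h hηreg
  have hηne : genericPoint (Spec (X.presheaf.stalk x)) ≠ closedPoint (X.presheaf.stalk x) := by
    intro hη
    apply hxs
    haveI : Flat (X.fromSpecStalk x) := flat_fromSpecStalk X x
    have h := (mem_regularLocus_iff_of_flat_of_isPreimmersion (X.fromSpecStalk x) (closedPoint (X.presheaf.stalk x))).mp (hη ▸ hηreg)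
    rwa [Scheme.fromSpecStalk_closedPoint] at h
  -- `F` misses a point: a preimage of the generic point
  have hne : ∃ s : S', s ∉ F := by
    haveI := hg.isIso_compl
    obtain ⟨s, hs⟩ := RegularBlowupModelDim2.exists_preimage_of_isIso_morphismRestrict g
      ⟨(I.support : Set (Spec (X.presheaf.stalk x)))ᶜ, I.support.isClosed.isOpen_compl⟩ _ hηI
    exact ⟨s, fun h => hηne (hs ▸ h)⟩
  -- `S′` is FULL off `F`
  have hfull : ∀ s : S', s ∉ F → FullCl p (S'.presheaf.stalk s) := by
    intro s hs
    have hr : s ∈ Scheme.regularLocus S' := hreg s hs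
    rw [Scheme.mem_regularLocus] at hr
    haveI := hr
    haveI := FTemkinClosedPoints.charP_stalk_of_over p (X.fromSpecStalk x ≫ f) g s
    exact FTemkinClosedPoints.fullCl_of_isRegularLocalRing p _
  exact exists_fibreCentre_of_towerFull p n S' F hFcl hne hfull hn

/-! ## §4 The candidate door v42 «INTRINSIC-CENTRE» (by evidence only) -/

/-- door v41's deciding term with the F-half supplied by (TT): crux ⟸ four published theorems ∧ (TT) ∧ T″(p,e,1). [OURS · conditional] -/
theorem fInjectiveMacaulayfication_of_prints_of_TT_of_tStepOne
    (hG : CossartPiltant2019General.{0}) (h081R : Stacks081R.{0}) (hP : CossartPiltant2019Principalization.{0})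
    (hM : CesnaviciusBlowupMacaulayficationOffClosed.{0})
    (hTT : IntrinsicTowerConjecture)
    (hT1 : ∀ p e : ℕ, p.Prime → 4 ≤ e → TrFullStep.LocalRegularizationFibreFullTr p e 1) :
    Summit.ResolutionOfSingularities.ResolutionOfSingularities.Theses.FrobeniusLadder.FInjectiveMacaulayfication :=
  TrFullStepDoor.fInjectiveMacaulayfication_of_prints_of_LFadmF_of_tStepOne hG h081R hP hM
    (localFInjectivizationFibreAdmGe4_of_intrinsicTowerConjecture hTT) hT1

end Summit.ResolutionOfSingularities.ResolutionOfSingularities.Theorems.FInjectiveMacaulayfication.IntrinsicTower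

end
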